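import Summits.QuantumFields.YangMills.Theorems.BalabanUVNodesN13GaugeFixingTargetDisjointBondFamily
import Literature.MathematicalPhysics.QuantumFieldTheory.Balaban1983to89.T4StabilityFloorUnitary
import Literature.MathematicalPhysics.QuantumFieldTheory.Balaban1983to89.T4PlaqDisjointFamilies

/-!
# BalabanUVNodes ∕ N13 — A GAUGE-FIXED GAUSSIAN LOWER BOUND ON BAŁABAN'S FINE-LATTICE WILSON PARTITION FUNCTION (`G = SU(N)`, on the record's own carrier)

(Track A, DAG node N13 = [B16]; cluster K1 — K1⁹ `StabilityBRunRowsAtRecordR13SepCoPHV` = stmt-QuantumFields-27364, helper; seat `pub-ymgap-dag-n13-w3` g5; 2026-08-28; count-neutral.)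
Second file deciding p625602's located «numerics question».  An UNCONDITIONAL lower bound on `log Z_{T^{(0)}}(β) = log ∫ e^{−βA(U)} dU` whose `|T₁^{(0)}|·log β` coefficient `(7∕4)(N²−1)`
is STRICTLY BELOW the `2(1−L⁻⁴)(N²−1)` that a coupling-blind normalisation `E(P)` carries (companion `…N13NormalisationNoGoCouplingBlindAtRecord13SepCoPHV`).

WHAT IS PROVED ([folklore] real arithmetic over `Missing.partitionFn`, `B16ZLower.suOpBall`, the matching gauge of `…N13GaugeFixingTargetDisjointBondFamily`; 0 `sorry`, 0 `def`):
`card_plaq_le` (`#plaquettes ≤ d²·|T|`), `log_haarReal_suOpBall_ge` (`log haar(suOpBall N τ) ≥ (N²−1) log τ − C_N`, `0 < τ ≤ 1`, from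
`B16ZLower.haarReal_suOpBall_ge`), `wilsonAction4_le_of_bondBall` (`A ≤ 8τ²·#plaq` on the bond box; `T4StabilityFloorUnitary.dist1_plaqHol_le_four_mul` +
`one_sub_reTr_le_half_dist1_sq_specialUnitary`), `pow_mul_partitionFn_ge_box` (`haar(B_τ)^{|M|}·Z ≥ e^{−8βτ²#plaq}·haar(B_τ)^{#bonds}` for every target-disjoint `M`), and
★★★ `log_partitionFn_ge_gaugeFixed_specialUnitary` — for every `P : Params`, `β ≥ 1`:
`log Z_P(β) ≥ −((d − ½)(N²−1)∕2)·|T₁^{(0)}|·log β − (8d² + (d − ½)·C_N)·|T₁^{(0)}|`, `C_N = N²·log(16π+1) + log((2N+1)∕(4π))`; `…_d4`: for `d = 4` the coefficient is `(7∕4)(N²−1)`.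
WHY THE MATCHING: without gauge fixing the box bound has `log β`-coefficient `(d∕2)(N²−1) = 2(N²−1)`, which does NOT beat the normalisation's `2(1−L⁻⁴)(N²−1)`; gauging away `|T|∕2` bonds
exactly gives `(7∕4)(N²−1) < (15∕8)(N²−1)` (a full tree gauge would give print's `(3∕2)(N²−1)`).
HONEST FRAMING: elementary; nothing of Bałaban's asserted or refuted; no skeleton ∕ route text touched; N13 NOT discharged; K1⁹ NEITHER proved NOR refuted; counts UNMOVED (typed 28∕28 ·
discharged 5∕27 · A 5∕28); R4 closes the conditional finite-𝕋⁴ rung `BalabanLadder.UV` only — the Yang–Mills mass gap (Clay) is NOT proved by any of this; nothing continuum ∕ ℝ⁴ ∕ OS.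
No `sorry`, `def`, `instance`, `notation`.
-/

noncomputable section

open MeasureTheory
open scoped BigOperators

namespace Summit.QuantumFields.YangMills.BalabanUVNodes.N13WilsonPartitionFnGaugeFixedLowerBound

open Literature.MathematicalPhysics.QuantumFieldTheory.Balaban1983to89
open Missing
open Summit.QuantumFields.YangMills.BalabanUVNodes.N13GaugeFixingTargetDisjointBondFamily
  (exists_targetDisjoint_matching pow_mul_partitionFn_eq)

/-! ## §1. Counts, the small-ball logarithm, the action on the bond box, and the lower bound -/

section LowerBound

open B16ZLower T4StabilityFloorUnitary

variable (N : ℕ) [NeZero N]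

/-- Plaquette count: `#plaquettes(T^{(j)}) ≤ d²·|T₁^{(j)}|`. [folklore] -/
theorem card_plaq_le (P : Params) (j : ℕ) : Fintype.card (Plaq P j) ≤ Fintype.card (Site P j) * (P.d * P.d) := by
  have h := Fintype.card_le_of_injective (fun p : Plaq P j => (p.src, p.μ, p.ν)) (by
    intro p q h
    obtain ⟨s, μ, ν, hμν⟩ := p
    obtain ⟨s', μ', ν', hμν'⟩ := q
    simp only [Prod.mk.injEq] at h
    obtain ⟨rfl, rfl, rfl⟩ := h
    rfl)
  simpa [Fintype.card_prod, Fintype.card_fin] using h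

/-- The logarithm of the explicit `SU(N)` small-ball mass: for `0 < τ ≤ 1`,
`log haar(suOpBall N τ) ≥ (N² − 1)·log τ − (N²·log(16π + 1) + log((2N + 1)∕(4π)))` (`B16ZLower.haarReal_suOpBall_ge`). [folklore] -/
theorem log_haarReal_suOpBall_ge {τ : ℝ} (hτ : 0 < τ) (hτ1 : τ ≤ 1) :
    (((N * N : ℕ) : ℝ) - 1) * Real.log τ - (((N * N : ℕ) : ℝ) * Real.log (16 * Real.pi + 1) + Real.log ((2 * N + 1) / (4 * Real.pi))) ≤
      Real.log ((HaarData.haar : Measure (Matrix.specialUnitaryGroup (Fin N) ℂ)).real (suOpBall N τ)) := by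
  have hπ := Real.pi_pos
  have h := haarReal_suOpBall_ge (N := N) hτ
  have h2N : (0 : ℝ) < 2 * N + 1 := by positivity
  have hA : 0 < 4 * Real.pi / ((2 * N + 1) * τ) := by positivity
  have hBq : 0 < (τ / (16 * Real.pi + τ)) ^ (N * N) := by positivity
  have hq : 0 < 4 * Real.pi / ((2 * N + 1) * τ) * (τ / (16 * Real.pi + τ)) ^ (N * N) := mul_pos hA hBq
  refine le_trans ?_ (Real.log_le_log hq h)
  have eA : Real.log (4 * Real.pi / ((2 * N + 1) * τ)) = Real.log (4 * Real.pi) - (Real.log (2 * N + 1) + Real.log τ) := by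
    rw [Real.log_div (by positivity) (by positivity), Real.log_mul h2N.ne' hτ.ne']
  have eB : Real.log ((τ / (16 * Real.pi + τ)) ^ (N * N)) = ((N * N : ℕ) : ℝ) * (Real.log τ - Real.log (16 * Real.pi + τ)) := by
    rw [Real.log_pow, Real.log_div hτ.ne' (by positivity)]
  have eC : Real.log (4 * Real.pi / ((2 * N + 1) * τ) * (τ / (16 * Real.pi + τ)) ^ (N * N)) =
      Real.log (4 * Real.pi / ((2 * N + 1) * τ)) + Real.log ((τ / (16 * Real.pi + τ)) ^ (N * N)) := Real.log_mul hA.ne' hBq.ne'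
  have eD : Real.log ((2 * N + 1) / (4 * Real.pi)) = Real.log (2 * N + 1) - Real.log (4 * Real.pi) :=
    Real.log_div h2N.ne' (by positivity)
  have e3 : Real.log (16 * Real.pi + τ) ≤ Real.log (16 * Real.pi + 1) := Real.log_le_log (by positivity) (by linarith)
  have e3' : ((N * N : ℕ) : ℝ) * Real.log (16 * Real.pi + τ) ≤ ((N * N : ℕ) : ℝ) * Real.log (16 * Real.pi + 1) :=
    mul_le_mul_of_nonneg_left e3 (Nat.cast_nonneg _)
  rw [eC, eA, eB, eD]
  nlinarith [e3', Nat.cast_nonneg (α := ℝ) (N * N)]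

/-- On the bond box `{∀ b, U(b) ∈ suOpBall N τ}` the Wilson action is at most `8τ²·#plaquettes`
(`|U(∂p) − 1| ≤ 4τ`, `1 − Re tr ≤ ½|· − 1|²`). [folklore] -/
theorem wilsonAction4_le_of_bondBall {P : Params} {j : ℕ} {τ : ℝ} {U : GaugeField P j (Matrix.specialUnitaryGroup (Fin N) ℂ)}
    (hU : ∀ b, U b ∈ suOpBall N τ) : wilsonAction4 U ≤ 8 * τ ^ 2 * Fintype.card (Plaq P j) := by
  rw [wilsonAction4_eq_sum]
  have hb : ∀ b, dist1 (U b) ≤ τ := fun b => mem_suOpBall_iff_dist1.1 (hU b)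
  have hp : ∀ p : Plaq P j, 1 - reTr (GaugeField.plaqHol U p) ≤ 8 * τ ^ 2 := by
    intro p
    have h1 := one_sub_reTr_le_half_dist1_sq_specialUnitary (N := N) (GaugeField.plaqHol U p)
    have h2 : dist1 (GaugeField.plaqHol U p) ≤ 4 * τ := dist1_plaqHol_le_four_mul hb p
    have h3 : dist1 (GaugeField.plaqHol U p) ^ 2 ≤ (4 * τ) ^ 2 :=
      pow_le_pow_left₀ (GaugeGroup.dist1_nonneg _) h2 2
    nlinarith
  calc ∑ p, (1 - reTr (GaugeField.plaqHol U p)) ≤ ∑ _p : Plaq P j, 8 * τ ^ 2 := Finset.sum_le_sum fun p _ => hp p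
    _ = 8 * τ ^ 2 * Fintype.card (Plaq P j) := by rw [Finset.sum_const, Finset.card_univ, nsmul_eq_mul, mul_comm]

/-- **THE BOX BOUND AFTER THE MATCHING GAUGE** (any target-disjoint `M`, any `τ > 0`, `β ≥ 0`):
`haar(B_τ)^{|M|}·Z ≥ e^{−8βτ²·#plaq}·haar(B_τ)^{#bonds}`, `B_τ = suOpBall N τ`. [folklore] -/
theorem pow_mul_partitionFn_ge_box (P : Params) (M : Finset (PBond P 0)) (hsrc : ∀ b ∈ M, ∀ b' ∈ M, b'.tgt ≠ b.src)
    (hinj : Set.InjOn PBond.tgt (M : Set (PBond P 0))) {τ β : ℝ} (hβ : 0 ≤ β) :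
    Real.exp (-(β * (8 * τ ^ 2 * Fintype.card (Plaq P 0)))) *
        (HaarData.haar : Measure (Matrix.specialUnitaryGroup (Fin N) ℂ)).real (suOpBall N τ) ^ Fintype.card (PBond P 0) ≤
      (HaarData.haar : Measure (Matrix.specialUnitaryGroup (Fin N) ℂ)).real (suOpBall N τ) ^ M.card *
        partitionFn (G := Matrix.specialUnitaryGroup (Fin N) ℂ) P β := by
  classical
  set G := Matrix.specialUnitaryGroup (Fin N) ℂ
  set B : Set G := suOpBall N τ with hBdef
  have hB : MeasurableSet B := measurableSet_suOpBall τ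
  set c : ℝ := (HaarData.haar : Measure G).real B with hc
  rw [pow_mul_partitionFn_eq P M hsrc hinj hB hβ]
  -- the lower function: `e^{−8βτ²#plaq} · Π_{all bonds} 1_B`
  set a : ℝ := Real.exp (-(β * (8 * τ ^ 2 * Fintype.card (Plaq P 0)))) with ha
  have hlow_int : ∫ U, a * ∏ b, B.indicator (fun _ => (1 : ℝ)) (U b) ∂(fieldMeasure P 0 G) = a * c ^ Fintype.card (PBond P 0) := by
    rw [integral_const_mul]
    congr 1
    show (∫ U : PBond P 0 → G, ∏ b, B.indicator (fun _ => (1 : ℝ)) (U b) ∂(Measure.pi fun _ : PBond P 0 => (HaarData.haar : Measure G))) = _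
    rw [integral_fintype_prod_eq_prod (fun (_ : PBond P 0) (w : G) => B.indicator (fun _ => (1 : ℝ)) w)]
    have hone : (∫ w : G, B.indicator (fun _ => (1 : ℝ)) w ∂(HaarData.haar : Measure G)) = c := integral_indicator_one hB
    simp only [hone]
    rw [Finset.prod_const, Finset.card_univ]
  rw [← hlow_int]
  -- integrability of the upper function
  have hprod_meas : Measurable fun U : GaugeField P 0 G => ∏ b ∈ M, B.indicator (fun _ => (1 : ℝ)) (U b) :=
    Finset.measurable_prod _ fun b _ => (measurable_const.indicator hB).comp (measurable_pi_apply b)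
  have hprod_bdd : ∀ U : GaugeField P 0 G, ‖∏ b ∈ M, B.indicator (fun _ => (1 : ℝ)) (U b)‖ ≤ 1 := by
    intro U
    rw [Real.norm_eq_abs, Finset.abs_prod]
    refine Finset.prod_le_one (fun b _ => abs_nonneg _) fun b _ => ?_
    rw [abs_of_nonneg (Set.indicator_nonneg (fun _ _ => zero_le_one) _)]
    exact Set.indicator_le_self' (fun _ _ => zero_le_one) _
  have hup_int : Integrable (fun U : GaugeField P 0 G => boltzmann P β U * ∏ b ∈ M, B.indicator (fun _ => (1 : ℝ)) (U b)) (fieldMeasure P 0 G) := by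
    have h := (integrable_boltzmann RegularGaugeGroup.measurable_reTr P hβ (G := G)).bdd_mul hprod_meas.aestronglyMeasurable
      (Filter.Eventually.of_forall hprod_bdd)
    refine h.congr (Filter.Eventually.of_forall fun U => ?_)
    ring
  refine integral_mono_of_nonneg (Filter.Eventually.of_forall fun U => ?_) hup_int (Filter.Eventually.of_forall fun U => ?_)
  · exact mul_nonneg (Real.exp_nonneg _) (Finset.prod_nonneg fun b _ => Set.indicator_nonneg (fun _ _ => zero_le_one) _)
  · -- pointwise comparison
    show a * ∏ b, B.indicator (fun _ => (1 : ℝ)) (U b) ≤ boltzmann P β U * ∏ b ∈ M, B.indicator (fun _ => (1 : ℝ)) (U b)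
    by_cases hall : ∀ b, U b ∈ B
    · have h1 : ∏ b, B.indicator (fun _ => (1 : ℝ)) (U b) = 1 := Finset.prod_eq_one fun b _ => by simp [Set.indicator_of_mem (hall b)]
      have h2 : ∏ b ∈ M, B.indicator (fun _ => (1 : ℝ)) (U b) = 1 := Finset.prod_eq_one fun b _ => by simp [Set.indicator_of_mem (hall b)]
      rw [h1, h2, mul_one, mul_one, ha, boltzmann]
      refine Real.exp_le_exp.2 ?_
      have hA := wilsonAction4_le_of_bondBall N (P := P) (j := 0) (τ := τ) (U := U) hall
      nlinarith
    · simp only [not_forall] at hall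
      obtain ⟨b₀, hb₀⟩ := hall
      have h1 : ∏ b, B.indicator (fun _ => (1 : ℝ)) (U b) = 0 :=
        Finset.prod_eq_zero (Finset.mem_univ b₀) (Set.indicator_of_notMem hb₀ _)
      rw [h1, mul_zero]
      exact mul_nonneg (boltzmann_pos P β U).le (Finset.prod_nonneg fun b _ => Set.indicator_nonneg (fun _ _ => zero_le_one) _)

/-- **★★★ THE GAUGE-FIXED GAUSSIAN LOWER BOUND ON BAŁABAN's FINE-LATTICE WILSON PARTITION FUNCTION, `G = SU(N)`.**  For every `P : Params` and every
`β ≥ 1`:  `log Z_P(β) ≥ −((d − ½)(N² − 1)∕2)·|T₁^{(0)}|·log β − (8d² + (d − ½)·C_N)·|T₁^{(0)}|`, `C_N = N²·log(16π+1) + log((2N+1)∕(4π))` — the matching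
`M₀` of §2 gauged away by §1, the remaining `(d − ½)|T|` bonds put in the ball of radius `β^{−1∕2}` where the action per plaquette is `≤ 8∕β`.
[folklore] -/
theorem log_partitionFn_ge_gaugeFixed_specialUnitary (P : Params) {β : ℝ} (hβ : 1 ≤ β) :
    -(((P.d : ℝ) - 1 / 2) * ((((N * N : ℕ) : ℝ) - 1) / 2)) * (Fintype.card (Site P 0) : ℝ) * Real.log β
        - (8 * (P.d : ℝ) ^ 2 + ((P.d : ℝ) - 1 / 2) * (((N * N : ℕ) : ℝ) * Real.log (16 * Real.pi + 1) + Real.log ((2 * N + 1) / (4 * Real.pi)))) *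
          (Fintype.card (Site P 0) : ℝ) ≤
      Real.log (partitionFn (G := Matrix.specialUnitaryGroup (Fin N) ℂ) P β) := by
  classical
  set G := Matrix.specialUnitaryGroup (Fin N) ℂ
  have hβ0 : 0 < β := lt_of_lt_of_le one_pos hβ
  -- radius `τ = β^{−1/2}`
  set τ : ℝ := (Real.sqrt β)⁻¹ with hτdef
  have hsq : 0 < Real.sqrt β := Real.sqrt_pos.2 hβ0
  have hτ : 0 < τ := inv_pos.2 hsq
  have hτ1 : τ ≤ 1 := by
    rw [hτdef]
    exact inv_le_one_of_one_le₀ (Real.one_le_sqrt.2 hβ)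
  have hτsq : τ ^ 2 = β⁻¹ := by rw [hτdef, inv_pow, Real.sq_sqrt hβ0.le]
  have hlogτ : Real.log τ = -(1 / 2) * Real.log β := by
    rw [hτdef, Real.log_inv, Real.log_sqrt hβ0.le]; ring
  -- the matching and the box bound
  obtain ⟨M, hsrc, hinj, hcard⟩ := exists_targetDisjoint_matching P 0
  set c : ℝ := (HaarData.haar : Measure G).real (suOpBall N τ) with hc
  have hcpos : 0 < c := haarReal_suOpBall_pos (N := N) hτ
  have hbox := pow_mul_partitionFn_ge_box N P M hsrc hinj (τ := τ) hβ0.le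
  have hZ : 0 < partitionFn (G := G) P β := partitionFn_pos' P hβ0.le
  -- counts
  set T : ℕ := Fintype.card (Site P 0) with hT
  have hbonds : Fintype.card (PBond P 0) = T * P.d := T4PlaqDisjointFamilies.card_pbond P 0
  have hplaq : Fintype.card (Plaq P 0) ≤ T * (P.d * P.d) := card_plaq_le P 0
  have hMle : M.card ≤ Fintype.card (PBond P 0) := by
    rw [← Finset.card_univ]; exact Finset.card_le_univ M
  -- divide the box bound by `c^{|M|}`
  have hsplit : c ^ Fintype.card (PBond P 0) = c ^ M.card * c ^ (Fintype.card (PBond P 0) - M.card) := by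
    rw [← pow_add, Nat.add_sub_cancel' hMle]
  have hZge : Real.exp (-(β * (8 * τ ^ 2 * Fintype.card (Plaq P 0)))) * c ^ (Fintype.card (PBond P 0) - M.card) ≤ partitionFn (G := G) P β := by
    have h1 : c ^ M.card * (Real.exp (-(β * (8 * τ ^ 2 * Fintype.card (Plaq P 0)))) * c ^ (Fintype.card (PBond P 0) - M.card)) ≤
        c ^ M.card * partitionFn (G := G) P β := by
      calc c ^ M.card * (Real.exp (-(β * (8 * τ ^ 2 * Fintype.card (Plaq P 0)))) * c ^ (Fintype.card (PBond P 0) - M.card))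
          = Real.exp (-(β * (8 * τ ^ 2 * Fintype.card (Plaq P 0)))) * c ^ Fintype.card (PBond P 0) := by rw [hsplit]; ring
        _ ≤ c ^ M.card * partitionFn (G := G) P β := hbox
    exact le_of_mul_le_mul_left h1 (pow_pos hcpos _)
  -- logarithms
  have hlogZ := Real.log_le_log (mul_pos (Real.exp_pos _) (pow_pos hcpos _)) hZge
  rw [Real.log_mul (Real.exp_pos _).ne' (pow_pos hcpos _).ne', Real.log_exp, Real.log_pow] at hlogZ
  refine le_trans ?_ hlogZ
  -- the exponent: `−β·8τ²·#plaq = −8·#plaq ≥ −8d²|T|`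
  have hexp : -(β * (8 * τ ^ 2 * Fintype.card (Plaq P 0))) = -(8 * (Fintype.card (Plaq P 0) : ℝ)) := by
    rw [hτsq]; field_simp
  have hplaqR : (Fintype.card (Plaq P 0) : ℝ) ≤ (T : ℝ) * ((P.d : ℝ) * (P.d : ℝ)) := by exact_mod_cast hplaq
  -- the ball: `log c ≥ (N²−1) log τ − C_N`, multiplied by the free-bond count `(d − ½)|T|`
  have hlogc := log_haarReal_suOpBall_ge N hτ hτ1
  have hfree : ((Fintype.card (PBond P 0) - M.card : ℕ) : ℝ) = ((P.d : ℝ) - 1 / 2) * (T : ℝ) := by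
    rw [Nat.cast_sub hMle, hbonds, Nat.cast_mul]
    have : (M.card : ℝ) = (T : ℝ) / 2 := by
      have h2 : ((2 * M.card : ℕ) : ℝ) = (T : ℝ) := by exact_mod_cast hcard
      push_cast at h2
      linarith
    rw [this]; ring
  have hfree_nonneg : 0 ≤ ((P.d : ℝ) - 1 / 2) * (T : ℝ) := by
    rw [← hfree]; exact Nat.cast_nonneg _
  have hNN : (0 : ℝ) ≤ ((N * N : ℕ) : ℝ) - 1 := by
    have hN1 : 1 ≤ N := Nat.pos_of_ne_zero (NeZero.ne N)
    have : (1 : ℝ) ≤ ((N * N : ℕ) : ℝ) := by exact_mod_cast Nat.one_le_iff_ne_zero.2 (Nat.mul_ne_zero (by omega) (by omega))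
    linarith
  rw [hexp, hfree]
  rw [hlogτ] at hlogc
  have hkey : ((P.d : ℝ) - 1 / 2) * (T : ℝ) *
      ((((N * N : ℕ) : ℝ) - 1) * (-(1 / 2) * Real.log β) - (((N * N : ℕ) : ℝ) * Real.log (16 * Real.pi + 1) + Real.log ((2 * N + 1) / (4 * Real.pi)))) ≤
      ((P.d : ℝ) - 1 / 2) * (T : ℝ) * Real.log c := mul_le_mul_of_nonneg_left hlogc hfree_nonneg
  nlinarith [hkey, hplaqR]

/-- **`d = 4`**: `log Z_P(β) ≥ −(7∕4)(N²−1)·|T₁^{(0)}|·log β − (128 + (7∕2)·C_N)·|T₁^{(0)}|` for `β ≥ 1`. [folklore] -/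
theorem log_partitionFn_ge_gaugeFixed_specialUnitary_d4 (P : Params) (hd : P.d = 4) {β : ℝ} (hβ : 1 ≤ β) :
    -(7 / 4 * (((N * N : ℕ) : ℝ) - 1)) * (Fintype.card (Site P 0) : ℝ) * Real.log β
        - (128 + 7 / 2 * (((N * N : ℕ) : ℝ) * Real.log (16 * Real.pi + 1) + Real.log ((2 * N + 1) / (4 * Real.pi)))) * (Fintype.card (Site P 0) : ℝ) ≤
      Real.log (partitionFn (G := Matrix.specialUnitaryGroup (Fin N) ℂ) P β) := by
  have h := log_partitionFn_ge_gaugeFixed_specialUnitary N P hβ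
  have hd4 : (P.d : ℝ) = 4 := by exact_mod_cast hd
  rw [hd4] at h
  refine le_trans (le_of_eq ?_) h
  ring

end LowerBound

end Summit.QuantumFields.YangMills.BalabanUVNodes.N13WilsonPartitionFnGaugeFixedLowerBound

end
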